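import Literature.Analysis.OperatorTheory.HeterogeneousCyclicPeeling
import HarnessLib

/-!
# Slab operators of a time-sliced model: fibre integration and contraction of block interiors — PROVED

Topic `Literature/Analysis/OperatorTheory`; companion of `HeterogeneousCyclicPeeling.lean` (heterogeneous bond kernels
around a cycle, `integral_cyclic_insert_one/two`, block contraction for ONE space of site variables) and
`PathKernelDomination.lean` (the `r+1`-step path kernel dominating a bond operator).  Here the cycle `ℤ/N` of SLICE
variables `xₜ ∈ X` (probability `μ`) carries in addition FIBRE variables `γₜ ∈ Γ` (probability `ν`; in a lattice gauge
theory the temporal links between slice `t` and slice `t+1`), the weight is `∏ₜ c(xₜ, γₜ, xₜ₊₁)` with a bounded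
measurable `0 ≤ c ≤ C_c`, and observables are bounded measurable BLOCK functions `α(x_A, γ_A)` of `r + 2` consecutive
slices and the `r + 1` fibres between them.  Integrating out the fibres and the block interiors gives the transfer-matrix
picture (Osterwalder–Seiler: observables of finite time-width become bounded bond operators dominated by `‖A‖∞ 𝕋ʷ`): the
fibre-averaged kernel `K(x,x') = ∫ c(x,γ,x') dν(γ)` on the free bonds and the CONTRACTED BLOCK KERNEL
`X_α(u,u') = ∫∫ α(u ∷ v :: u', γ⃗) ∏ᵢ c((u ∷ v :: u')ᵢ, γᵢ, (u ∷ v :: u')ᵢ₊₁) dν^{⊗(r+1)}(γ⃗) dμ^{⊗r}(v)` on the block: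

* `slab_integral_pi_relabel`, `slab_zmod_equiv` — relabelling a finite product integral along an equivalence of index
  types; an injective `ℕ`-valued labelling below `N` of a finite type of cardinality `N` IS a relabelling `S ≃ ZMod N`
  (all windows and arcs of the cycle are addressed through such labellings, so only the arithmetic of `ℕ`-casts into
  `ZMod N` is ever used — no `ZMod N = Fin N` unfolding);
* `slab_integral_pi_two_blocks`, `slab_integral_pi_window{,_one,_two}` — independent blocks of coordinates, also sharing
  a one-body product weight `∏ₜ φₜ(γₜ)` (the fibre integration: window fibres jointly, free fibres one by one);
* `slab_integral_pi_sum_fubini`, `slab_integral_pi_split` — Fubini, outer block of coordinates versus inner block, for a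
  bounded measurable function of the configuration (the contraction of block interiors);
* `slab_kernel_*`, `slab_blockWeight_*`, `slab_blockKernel_*` — measurability and bounds of `K`, of the fibre-contracted
  block weight `Ψ_α(W) = ∫ α(W,γ⃗) ∏ᵢ c(Wᵢ,γᵢ,Wᵢ₊₁) dν^{⊗(r+1)}` and of `X_α` (joint strong measurability,
  `|X_α| ≤ C_α ∫ ∏ᵢ K dμ^{⊗r} ≤ C_α C_c^{r+1}`);
* `slab_cyclic_zero`, `slab_cyclic_one`, `slab_cyclic_two` (**main**) — the cyclic integral over `μ^{⊗ℤ/N} ⊗ ν^{⊗ℤ/N}`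
  with NO block is the pure `K`-cycle on `Fin N`; with ONE block (sites `0..r+1`) it is the one-insertion cycle
  `X_α, K, …, K` of `integral_cyclic_insert_one`'s shape; with TWO blocks (sites `0..r+1` and `r+a+3..2r+a+4`,
  `N = 2r+a+b'+6`) it is the two-insertion cycle on `Fin (a+b'+6)` with `X_α` (bond `0`), `X_β` (bond `a+3`) and `K`
  elsewhere — literally the left-hand side of `integral_cyclic_insert_two (a := a+2) (b' := b'+1)` (the path-space form
  of `Tr(𝕏_α 𝕂^{a+2} 𝕏_β 𝕂^{b'+2})` used by second-moment estimates of slab observables).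

Everything is `[folklore]` (Fubini–Tonelli on finite products of probability spaces); Mathlib + the companion files only;
no definitions (`K`, `Ψ_α`, `X_α` are written out, in the literal shapes consumed downstream).
-/

noncomputable section

open MeasureTheory Filter

namespace Literature.Analysis.OperatorTheory

section Generic

variable {Y : Type*} [MeasurableSpace Y]

/-- **Relabelling a product integral** along an equivalence `e : S ≃ ι` of finite index types:
`∫ G(x) dρ^{⊗ι}(x) = ∫ G(V ∘ e⁻¹) dρ^{⊗S}(V)`. [folklore] -/
theorem slab_integral_pi_relabel {S ι : Type*} [Fintype S] [Fintype ι] (ρ : Measure Y) [SigmaFinite ρ]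
    (e : S ≃ ι) (G : (ι → Y) → ℝ) :
    ∫ x, G x ∂(Measure.pi fun _ : ι => ρ) = ∫ V, G (fun t => V (e.symm t)) ∂(Measure.pi fun _ : S => ρ) := by
  have h : MeasurePreserving (MeasurableEquiv.piCongrLeft (fun _ : ι => Y) e)
      (Measure.pi fun _ : S => ρ) (Measure.pi fun _ : ι => ρ) :=
    measurePreserving_piCongrLeft (fun _ : ι => ρ) e
  rw [← h.integral_comp']
  refine integral_congr_ae (Eventually.of_forall fun V => ?_)
  show G _ = G _
  congr 1
  funext t
  simp only [MeasurableEquiv.coe_piCongrLeft, Equiv.piCongrLeft_apply_eq_cast, cast_eq]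

/-- **Relabellings into `ZMod N`.** An `ℕ`-valued map `g` on a finite type `S` of cardinality `N` which is
injective with values below `N` induces an equivalence `e : S ≃ ZMod N` with `e s = g s (mod N)`. [folklore] -/
theorem slab_zmod_equiv {S : Type*} [Fintype S] {N : ℕ} [NeZero N] (g : S → ℕ) (hlt : ∀ s, g s < N)
    (hinj : ∀ s s', g s = g s' → s = s') (hcard : Fintype.card S = N) :
    ∃ e : S ≃ ZMod N, ∀ s, e s = ((g s : ℕ) : ZMod N) := by
  have hbij : Function.Bijective fun s => ((g s : ℕ) : ZMod N) := by
    refine (Fintype.bijective_iff_injective_and_card _).2 ⟨fun s s' h => hinj s s' ?_, by rw [hcard, ZMod.card]⟩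
    have h' := congrArg ZMod.val h
    simpa only [ZMod.val_cast_of_lt (hlt _)] using h'
  exact ⟨Equiv.ofBijective _ hbij, fun _ => rfl⟩

/-- **Independent blocks of coordinates**: along `e : A ⊕ B ≃ ι`,
`∫ f(x ∘ e ∘ inl) g(x ∘ e ∘ inr) dρ^{⊗ι}(x) = (∫ f dρ^{⊗A}) (∫ g dρ^{⊗B})`. [folklore] -/
theorem slab_integral_pi_two_blocks {A B ι : Type*} [Fintype A] [Fintype B] [Fintype ι] (ρ : Measure Y)
    [SigmaFinite ρ] (e : A ⊕ B ≃ ι) (f : (A → Y) → ℝ) (g : (B → Y) → ℝ) :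
    ∫ x, f (fun i => x (e (Sum.inl i))) * g (fun j => x (e (Sum.inr j))) ∂(Measure.pi fun _ : ι => ρ) =
      (∫ y, f y ∂(Measure.pi fun _ : A => ρ)) * ∫ z, g z ∂(Measure.pi fun _ : B => ρ) := by
  rw [slab_integral_pi_relabel ρ e]
  simp only [Equiv.symm_apply_apply]
  have h2 : MeasurePreserving (MeasurableEquiv.sumPiEquivProdPi fun _ : A ⊕ B => Y)
      (Measure.pi fun _ : A ⊕ B => ρ) ((Measure.pi fun _ : A => ρ).prod (Measure.pi fun _ : B => ρ)) :=
    measurePreserving_sumPiEquivProdPi (fun _ : A ⊕ B => ρ)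
  rw [← integral_prod_mul f g, ← h2.integral_comp']
  rfl

/-- **A window and the rest, sharing a one-body product weight**: along `e : A ⊕ B ≃ ι`,
`∫ f(γ ∘ e ∘ inl) g(γ ∘ e ∘ inr) ∏ₜ φₜ(γₜ) dν^{⊗ι} = (∫ f(γ_A) ∏ᵢ φ_{e(inl i)}(γ_A i)) (∫ g(γ_B) ∏ⱼ φ_{e(inr j)}(γ_B j))`.
[folklore] -/
theorem slab_integral_pi_window {A B ι : Type*} [Fintype A] [Fintype B] [Fintype ι] (ρ : Measure Y)
    [SigmaFinite ρ] (e : A ⊕ B ≃ ι) (φ : ι → Y → ℝ) (f : (A → Y) → ℝ) (g : (B → Y) → ℝ) :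
    ∫ x, f (fun i => x (e (Sum.inl i))) * g (fun j => x (e (Sum.inr j))) * ∏ t, φ t (x t)
        ∂(Measure.pi fun _ : ι => ρ) =
      (∫ y, f y * ∏ i, φ (e (Sum.inl i)) (y i) ∂(Measure.pi fun _ : A => ρ)) *
        ∫ z, g z * ∏ j, φ (e (Sum.inr j)) (z j) ∂(Measure.pi fun _ : B => ρ) := by
  have hprod : ∀ x : ι → Y, ∏ t, φ t (x t) =
      (∏ i, φ (e (Sum.inl i)) (x (e (Sum.inl i)))) * ∏ j, φ (e (Sum.inr j)) (x (e (Sum.inr j))) := by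
    intro x
    rw [← Fintype.prod_equiv e (fun w => φ (e w) (x (e w))) (fun t => φ t (x t)) (fun w => rfl),
      Fintype.prod_sum_type]
  simp_rw [hprod]
  rw [← slab_integral_pi_two_blocks ρ e (fun y => f y * ∏ i, φ (e (Sum.inl i)) (y i))
    (fun z => g z * ∏ j, φ (e (Sum.inr j)) (z j))]
  refine integral_congr_ae (Eventually.of_forall fun x => ?_)
  dsimp only
  ring

/-- **Fubini over two blocks of coordinates**: for a bounded measurable `G` of an `A ⊕ B`-indexed configuration
and a finite measure `ρ`, `∫ G dρ^{⊗(A ⊕ B)} = ∫ (∫ G(W ⊔ v) dρ^{⊗B}(v)) dρ^{⊗A}(W)`. [folklore] -/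
theorem slab_integral_pi_sum_fubini {A B : Type*} [Fintype A] [Fintype B] (ρ : Measure Y) [IsFiniteMeasure ρ]
    {G : (A ⊕ B → Y) → ℝ} (hG : Measurable G) {C : ℝ} (hGb : ∀ x, ‖G x‖ ≤ C) :
    ∫ x, G x ∂(Measure.pi fun _ : A ⊕ B => ρ) =
      ∫ W, ∫ v, G (Sum.elim W v) ∂(Measure.pi fun _ : B => ρ) ∂(Measure.pi fun _ : A => ρ) := by
  have h2 : MeasurePreserving (MeasurableEquiv.sumPiEquivProdPi fun _ : A ⊕ B => Y).symm
      ((Measure.pi fun _ : A => ρ).prod (Measure.pi fun _ : B => ρ)) (Measure.pi fun _ : A ⊕ B => ρ) :=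
    measurePreserving_sumPiEquivProdPi_symm (fun _ : A ⊕ B => ρ)
  have he : ∀ p : (A → Y) × (B → Y),
      (MeasurableEquiv.sumPiEquivProdPi fun _ : A ⊕ B => Y).symm p = Sum.elim p.1 p.2 := fun p => by
    funext s; cases s <;> rfl
  rw [← h2.integral_comp']
  have hm : Measurable fun p : (A → Y) × (B → Y) => (Sum.elim p.1 p.2 : A ⊕ B → Y) := by
    refine measurable_pi_iff.2 fun s => ?_
    cases s with
    | inl a => exact (measurable_pi_apply a).comp measurable_fst
    | inr b => exact (measurable_pi_apply b).comp measurable_snd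
  have hint : Integrable (fun p : (A → Y) × (B → Y) => G (Sum.elim p.1 p.2))
      ((Measure.pi fun _ : A => ρ).prod (Measure.pi fun _ : B => ρ)) :=
    Integrable.of_bound (hG.comp hm).aestronglyMeasurable C (Eventually.of_forall fun p => hGb _)
  simp_rw [he]
  rw [integral_prod _ hint]

end Generic

section Model

variable {X Γ : Type*} [MeasurableSpace X] [MeasurableSpace Γ] {ν : Measure Γ} [IsProbabilityMeasure ν]
  {c : X → Γ → X → ℝ} {Cc : ℝ}

/-- The fibre-averaged kernel `K(x,x') = ∫ c(x,γ,x') dν(γ)` of a jointly measurable `c` is jointly measurable.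
[folklore] -/
theorem slab_kernel_measurable (hc : Measurable (fun q : X × Γ × X => c q.1 q.2.1 q.2.2)) :
    Measurable (Function.uncurry fun x x' : X => ∫ γ, c x γ x' ∂ν) := by
  have hm : Measurable fun q : (X × X) × Γ => c q.1.1 q.2 q.1.2 :=
    hc.comp ((measurable_fst.comp measurable_fst).prodMk
      (measurable_snd.prodMk (measurable_snd.comp measurable_fst)))
  exact (hm.stronglyMeasurable.integral_prod_right' (ν := ν)).measurable

omit [MeasurableSpace X] in
/-- `0 ≤ K ≤ C_c` for `0 ≤ c ≤ C_c` and a probability measure `ν`. [folklore] -/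
theorem slab_kernel_bounds (hcb : ∀ x γ x', 0 ≤ c x γ x' ∧ c x γ x' ≤ Cc) (x x' : X) :
    0 ≤ ∫ γ, c x γ x' ∂ν ∧ ∫ γ, c x γ x' ∂ν ≤ Cc := by
  refine ⟨integral_nonneg fun γ => (hcb x γ x').1, ?_⟩
  have h := norm_integral_le_of_norm_le_const (μ := ν) (f := fun γ => c x γ x') (C := Cc)
    (Eventually.of_forall fun γ => ?_)
  · rw [probReal_univ, mul_one, Real.norm_eq_abs] at h
    exact (le_abs_self _).trans h
  · rw [Real.norm_eq_abs, abs_of_nonneg (hcb x γ x').1]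
    exact (hcb x γ x').2

variable {r : ℕ} {α : (Fin (r + 2) → X) → (Fin (r + 1) → Γ) → ℝ} {Cα : ℝ}

/-- Joint measurability of the block integrand `(W, γ⃗) ↦ α(W, γ⃗) ∏ᵢ c(Wᵢ, γᵢ, Wᵢ₊₁)`. [folklore] -/
theorem slab_blockIntegrand_measurable (hc : Measurable (fun q : X × Γ × X => c q.1 q.2.1 q.2.2))
    (hα : Measurable (fun q : (Fin (r + 2) → X) × (Fin (r + 1) → Γ) => α q.1 q.2)) :
    Measurable fun q : (Fin (r + 2) → X) × (Fin (r + 1) → Γ) =>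
      α q.1 q.2 * ∏ i : Fin (r + 1), c (q.1 (Fin.castSucc i)) (q.2 i) (q.1 (Fin.succ i)) := by
  refine hα.mul (Finset.measurable_prod _ fun i _ => ?_)
  have h1 : Measurable fun q : (Fin (r + 2) → X) × (Fin (r + 1) → Γ) => q.1 (Fin.castSucc i) :=
    (measurable_pi_apply (Fin.castSucc i)).comp measurable_fst
  have h2 : Measurable fun q : (Fin (r + 2) → X) × (Fin (r + 1) → Γ) => q.2 i :=
    (measurable_pi_apply i).comp measurable_snd
  have h3 : Measurable fun q : (Fin (r + 2) → X) × (Fin (r + 1) → Γ) => q.1 (Fin.succ i) :=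
    (measurable_pi_apply (Fin.succ i)).comp measurable_fst
  exact hc.comp (h1.prodMk (h2.prodMk h3))

/-- Measurability of the fibre-contracted block weight
`Ψ_α(W) = ∫ α(W, γ⃗) ∏ᵢ c(Wᵢ, γᵢ, Wᵢ₊₁) dν^{⊗(r+1)}(γ⃗)` (a parametric integral of a jointly measurable
integrand). [folklore] -/
theorem slab_blockWeight_measurable (hc : Measurable (fun q : X × Γ × X => c q.1 q.2.1 q.2.2))
    (hα : Measurable (fun q : (Fin (r + 2) → X) × (Fin (r + 1) → Γ) => α q.1 q.2)) :
    Measurable fun W : Fin (r + 2) → X => ∫ γs, α W γs *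
      ∏ i : Fin (r + 1), c (W (Fin.castSucc i)) (γs i) (W (Fin.succ i)) ∂(Measure.pi fun _ => ν) :=
  ((slab_blockIntegrand_measurable hc hα).stronglyMeasurable.integral_prod_right'
    (ν := Measure.pi fun _ : Fin (r + 1) => ν)).measurable

/-- **Domination of the block weight**: `|Ψ_α(W)| ≤ C_α ∏ᵢ K(Wᵢ, Wᵢ₊₁)` (`|α| ≤ C_α`, `c ≥ 0`, and
`∫ ∏ᵢ c(Wᵢ, γᵢ, Wᵢ₊₁) dν^{⊗(r+1)} = ∏ᵢ K(Wᵢ, Wᵢ₊₁)` by `integral_fintype_prod_eq_prod`). [folklore] -/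
theorem slab_blockWeight_abs_le (hc : Measurable (fun q : X × Γ × X => c q.1 q.2.1 q.2.2))
    (hcb : ∀ x γ x', 0 ≤ c x γ x' ∧ c x γ x' ≤ Cc) (hαb : ∀ W γs, |α W γs| ≤ Cα) (W : Fin (r + 2) → X) :
    |∫ γs, α W γs * ∏ i : Fin (r + 1), c (W (Fin.castSucc i)) (γs i) (W (Fin.succ i)) ∂(Measure.pi fun _ => ν)| ≤
      Cα * ∏ i : Fin (r + 1), ∫ γ, c (W (Fin.castSucc i)) γ (W (Fin.succ i)) ∂ν := by
  have hK : ∫ γs : Fin (r + 1) → Γ, ∏ i : Fin (r + 1), c (W (Fin.castSucc i)) (γs i) (W (Fin.succ i))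
      ∂(Measure.pi fun _ => ν) = ∏ i : Fin (r + 1), ∫ γ, c (W (Fin.castSucc i)) γ (W (Fin.succ i)) ∂ν :=
    integral_fintype_prod_eq_prod (fun i γ => c (W (Fin.castSucc i)) γ (W (Fin.succ i)))
  rw [← hK, ← integral_const_mul, ← Real.norm_eq_abs]
  have hPm : Measurable fun γs : Fin (r + 1) → Γ =>
      ∏ i : Fin (r + 1), c (W (Fin.castSucc i)) (γs i) (W (Fin.succ i)) := by
    refine Finset.measurable_prod _ fun i _ => ?_
    have h1 : Measurable fun _γs : Fin (r + 1) → Γ => W (Fin.castSucc i) := measurable_const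
    have h2 : Measurable fun γs : Fin (r + 1) → Γ => γs i := measurable_pi_apply i
    have h3 : Measurable fun _γs : Fin (r + 1) → Γ => W (Fin.succ i) := measurable_const
    exact hc.comp (h1.prodMk (h2.prodMk h3))
  have hP0 : ∀ γs : Fin (r + 1) → Γ, 0 ≤ ∏ i : Fin (r + 1), c (W (Fin.castSucc i)) (γs i) (W (Fin.succ i)) :=
    fun γs => Finset.prod_nonneg fun i _ => (hcb _ _ _).1
  have hPb : ∀ γs : Fin (r + 1) → Γ,
      ∏ i : Fin (r + 1), c (W (Fin.castSucc i)) (γs i) (W (Fin.succ i)) ≤ Cc ^ (r + 1) := fun γs =>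
    calc _ ≤ ∏ _i : Fin (r + 1), Cc := Finset.prod_le_prod (fun i _ => (hcb _ _ _).1) fun i _ => (hcb _ _ _).2
      _ = Cc ^ (r + 1) := by simp
  have hint : Integrable (fun γs : Fin (r + 1) → Γ =>
      Cα * ∏ i : Fin (r + 1), c (W (Fin.castSucc i)) (γs i) (W (Fin.succ i))) (Measure.pi fun _ => ν) := by
    refine Integrable.of_bound (hPm.const_mul Cα).aestronglyMeasurable (|Cα| * Cc ^ (r + 1))
      (Eventually.of_forall fun γs => ?_)
    rw [norm_mul, Real.norm_eq_abs, Real.norm_eq_abs, abs_of_nonneg (hP0 γs)]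
    exact mul_le_mul_of_nonneg_left (hPb γs) (abs_nonneg _)
  refine norm_integral_le_of_norm_le hint (Eventually.of_forall fun γs => ?_)
  rw [norm_mul, Real.norm_eq_abs, Real.norm_eq_abs, abs_of_nonneg (hP0 γs)]
  exact mul_le_mul_of_nonneg_right (hαb W γs) (hP0 γs)

/-- The crude bound `|Ψ_α(W)| ≤ C_α C_c^{r+1}` (`Γ` is nonempty since `ν` is a probability measure, so
`0 ≤ C_α`). [folklore] -/
theorem slab_blockWeight_abs_le' (hc : Measurable (fun q : X × Γ × X => c q.1 q.2.1 q.2.2))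
    (hcb : ∀ x γ x', 0 ≤ c x γ x' ∧ c x γ x' ≤ Cc) (hαb : ∀ W γs, |α W γs| ≤ Cα) (W : Fin (r + 2) → X) :
    |∫ γs, α W γs * ∏ i : Fin (r + 1), c (W (Fin.castSucc i)) (γs i) (W (Fin.succ i)) ∂(Measure.pi fun _ => ν)| ≤
      Cα * Cc ^ (r + 1) := by
  have hΓ : Nonempty Γ := nonempty_of_isProbabilityMeasure ν
  have hCα : 0 ≤ Cα := (abs_nonneg _).trans (hαb W fun _ => Classical.choice hΓ)
  refine (slab_blockWeight_abs_le hc hcb hαb W).trans (mul_le_mul_of_nonneg_left ?_ hCα)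
  calc _ ≤ ∏ _i : Fin (r + 1), Cc := Finset.prod_le_prod (fun i _ => (slab_kernel_bounds hcb _ _).1)
          fun i _ => (slab_kernel_bounds hcb _ _).2
    _ = Cc ^ (r + 1) := by simp

variable {μ : Measure X} [IsProbabilityMeasure μ]

/-- **(a) Joint strong measurability of the contracted block kernel**
`X_α(u,u') = ∫∫ α(u ∷ v :: u', γ⃗) ∏ᵢ c(…) dν^{⊗(r+1)} dμ^{⊗r}` (two parametric integrals of jointly measurable
integrands, `StronglyMeasurable.integral_prod_right'`). [folklore] -/
theorem slab_blockKernel_stronglyMeasurable (hc : Measurable (fun q : X × Γ × X => c q.1 q.2.1 q.2.2))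
    (hα : Measurable (fun q : (Fin (r + 2) → X) × (Fin (r + 1) → Γ) => α q.1 q.2)) :
    StronglyMeasurable (Function.uncurry fun u u' : X => ∫ v : Fin r → X, ∫ γs : Fin (r + 1) → Γ,
      α (Fin.cons u (Fin.snoc v u')) γs * ∏ i : Fin (r + 1),
        c ((Fin.cons u (Fin.snoc v u') : Fin (r + 2) → X) (Fin.castSucc i)) (γs i)
          ((Fin.cons u (Fin.snoc v u') : Fin (r + 2) → X) (Fin.succ i)) ∂(Measure.pi fun _ => ν)
        ∂(Measure.pi fun _ => μ)) := by
  have hW : Measurable fun q : (X × X) × (Fin r → X) =>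
      (Fin.cons q.1.1 (Fin.snoc q.2 q.1.2) : Fin (r + 2) → X) :=
    (measurable_finCons (r + 1)).comp ((measurable_fst.comp measurable_fst).prodMk
      ((measurable_finSnoc r).comp (measurable_snd.prodMk (measurable_snd.comp measurable_fst))))
  have h2 := (slab_blockWeight_measurable (ν := ν) hc hα).comp hW
  exact h2.stronglyMeasurable.integral_prod_right' (ν := Measure.pi fun _ : Fin r => μ)

/-- **(b) Domination of the contracted block kernel** by `C_α` times the `(r+1)`-step path weight of `K`:
`|X_α(u,u')| ≤ C_α ∫ ∏ᵢ K((u ∷ v :: u')ᵢ, (u ∷ v :: u')ᵢ₊₁) dμ^{⊗r}(v)`. [folklore] -/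
theorem slab_blockKernel_abs_le (hc : Measurable (fun q : X × Γ × X => c q.1 q.2.1 q.2.2))
    (hcb : ∀ x γ x', 0 ≤ c x γ x' ∧ c x γ x' ≤ Cc) (hαb : ∀ W γs, |α W γs| ≤ Cα) (u u' : X) :
    |∫ v : Fin r → X, ∫ γs : Fin (r + 1) → Γ, α (Fin.cons u (Fin.snoc v u')) γs * ∏ i : Fin (r + 1),
        c ((Fin.cons u (Fin.snoc v u') : Fin (r + 2) → X) (Fin.castSucc i)) (γs i)
          ((Fin.cons u (Fin.snoc v u') : Fin (r + 2) → X) (Fin.succ i)) ∂(Measure.pi fun _ => ν)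
        ∂(Measure.pi fun _ => μ)| ≤
      Cα * (∫ v : Fin r → X, ∏ i : Fin (r + 1), (∫ γ, c ((Fin.cons u (Fin.snoc v u') : Fin (r + 2) → X)
        (Fin.castSucc i)) γ ((Fin.cons u (Fin.snoc v u') : Fin (r + 2) → X) (Fin.succ i)) ∂ν)
        ∂(Measure.pi fun _ => μ)) := by
  rw [← integral_const_mul, ← Real.norm_eq_abs]
  have hKm := slab_kernel_measurable (ν := ν) hc
  have hW : Measurable fun v : Fin r → X => (Fin.cons u (Fin.snoc v u') : Fin (r + 2) → X) :=
    (measurable_finCons (r + 1)).comp (measurable_const.prodMk ((measurable_finSnoc r).comp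
      (measurable_id.prodMk measurable_const)))
  have hPm : Measurable fun v : Fin r → X => ∏ i : Fin (r + 1),
      ∫ γ, c ((Fin.cons u (Fin.snoc v u') : Fin (r + 2) → X) (Fin.castSucc i)) γ
        ((Fin.cons u (Fin.snoc v u') : Fin (r + 2) → X) (Fin.succ i)) ∂ν := by
    refine Finset.measurable_prod _ fun i _ => ?_
    have h1 : Measurable fun v : Fin r → X => (Fin.cons u (Fin.snoc v u') : Fin (r + 2) → X) (Fin.castSucc i) :=
      (measurable_pi_apply (Fin.castSucc i)).comp hW
    have h3 : Measurable fun v : Fin r → X => (Fin.cons u (Fin.snoc v u') : Fin (r + 2) → X) (Fin.succ i) :=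
      (measurable_pi_apply (Fin.succ i)).comp hW
    exact hKm.comp (h1.prodMk h3)
  have hP0 : ∀ v : Fin r → X, 0 ≤ ∏ i : Fin (r + 1),
      ∫ γ, c ((Fin.cons u (Fin.snoc v u') : Fin (r + 2) → X) (Fin.castSucc i)) γ
        ((Fin.cons u (Fin.snoc v u') : Fin (r + 2) → X) (Fin.succ i)) ∂ν :=
    fun v => Finset.prod_nonneg fun i _ => (slab_kernel_bounds hcb _ _).1
  have hPb : ∀ v : Fin r → X, ∏ i : Fin (r + 1),
      ∫ γ, c ((Fin.cons u (Fin.snoc v u') : Fin (r + 2) → X) (Fin.castSucc i)) γ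
        ((Fin.cons u (Fin.snoc v u') : Fin (r + 2) → X) (Fin.succ i)) ∂ν ≤ Cc ^ (r + 1) := fun v =>
    calc _ ≤ ∏ _i : Fin (r + 1), Cc := Finset.prod_le_prod (fun i _ => (slab_kernel_bounds hcb _ _).1)
            fun i _ => (slab_kernel_bounds hcb _ _).2
      _ = Cc ^ (r + 1) := by simp
  have hint : Integrable (fun v : Fin r → X => Cα * ∏ i : Fin (r + 1),
      ∫ γ, c ((Fin.cons u (Fin.snoc v u') : Fin (r + 2) → X) (Fin.castSucc i)) γ
        ((Fin.cons u (Fin.snoc v u') : Fin (r + 2) → X) (Fin.succ i)) ∂ν) (Measure.pi fun _ => μ) := by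
    refine Integrable.of_bound (hPm.const_mul Cα).aestronglyMeasurable (|Cα| * Cc ^ (r + 1))
      (Eventually.of_forall fun v => ?_)
    rw [norm_mul, Real.norm_eq_abs, Real.norm_eq_abs, abs_of_nonneg (hP0 v)]
    exact mul_le_mul_of_nonneg_left (hPb v) (abs_nonneg _)
  refine norm_integral_le_of_norm_le hint (Eventually.of_forall fun v => ?_)
  rw [Real.norm_eq_abs]
  exact slab_blockWeight_abs_le hc hcb hαb _

/-- **(b') The crude bound** `|X_α(u,u')| ≤ C_α C_c^{r+1}`. [folklore] -/
theorem slab_blockKernel_abs_le' (hc : Measurable (fun q : X × Γ × X => c q.1 q.2.1 q.2.2))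
    (hcb : ∀ x γ x', 0 ≤ c x γ x' ∧ c x γ x' ≤ Cc) (hαb : ∀ W γs, |α W γs| ≤ Cα) (u u' : X) :
    |∫ v : Fin r → X, ∫ γs : Fin (r + 1) → Γ, α (Fin.cons u (Fin.snoc v u')) γs * ∏ i : Fin (r + 1),
        c ((Fin.cons u (Fin.snoc v u') : Fin (r + 2) → X) (Fin.castSucc i)) (γs i)
          ((Fin.cons u (Fin.snoc v u') : Fin (r + 2) → X) (Fin.succ i)) ∂(Measure.pi fun _ => ν)
        ∂(Measure.pi fun _ => μ)| ≤ Cα * Cc ^ (r + 1) := by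
  have hΓ : Nonempty Γ := nonempty_of_isProbabilityMeasure ν
  have hCα : 0 ≤ Cα := (abs_nonneg _).trans (hαb (fun _ => u) fun _ => Classical.choice hΓ)
  refine (slab_blockKernel_abs_le hc hcb hαb u u').trans (mul_le_mul_of_nonneg_left ?_ hCα)
  have hP0 : ∀ v : Fin r → X, 0 ≤ ∏ i : Fin (r + 1),
      ∫ γ, c ((Fin.cons u (Fin.snoc v u') : Fin (r + 2) → X) (Fin.castSucc i)) γ
        ((Fin.cons u (Fin.snoc v u') : Fin (r + 2) → X) (Fin.succ i)) ∂ν :=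
    fun v => Finset.prod_nonneg fun i _ => (slab_kernel_bounds hcb _ _).1
  have h := norm_integral_le_of_norm_le_const (μ := Measure.pi fun _ : Fin r => μ)
    (f := fun v : Fin r → X => ∏ i : Fin (r + 1),
      ∫ γ, c ((Fin.cons u (Fin.snoc v u') : Fin (r + 2) → X) (Fin.castSucc i)) γ
        ((Fin.cons u (Fin.snoc v u') : Fin (r + 2) → X) (Fin.succ i)) ∂ν) (C := Cc ^ (r + 1))
    (Eventually.of_forall fun v => ?_)
  · rw [probReal_univ, mul_one, Real.norm_eq_abs] at h
    exact (le_abs_self _).trans h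
  · rw [Real.norm_eq_abs, abs_of_nonneg (hP0 v)]
    calc _ ≤ ∏ _i : Fin (r + 1), Cc := Finset.prod_le_prod (fun i _ => (slab_kernel_bounds hcb _ _).1)
            fun i _ => (slab_kernel_bounds hcb _ _).2
      _ = Cc ^ (r + 1) := by simp

end Model

section Windows

variable {Y : Type*} [MeasurableSpace Y]

/-- **One window and free fibres**: along `e : A ⊕ B ≃ ι`, with the coordinates of `B` entering only through
the one-body weight, `∫ f(γ ∘ e ∘ inl) ∏ₜ φₜ(γₜ) dρ^{⊗ι} = (∫ f(y) ∏ᵢ φ_{e(inl i)}(yᵢ) dρ^{⊗A}) ∏ⱼ ∫ φ_{e(inr j)} dρ`.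
[folklore] -/
theorem slab_integral_pi_window_one {A B ι : Type*} [Fintype A] [Fintype B] [Fintype ι] (ρ : Measure Y)
    [SigmaFinite ρ] (e : A ⊕ B ≃ ι) (φ : ι → Y → ℝ) (f : (A → Y) → ℝ) :
    ∫ x, f (fun i => x (e (Sum.inl i))) * ∏ t, φ t (x t) ∂(Measure.pi fun _ : ι => ρ) =
      (∫ y, f y * ∏ i, φ (e (Sum.inl i)) (y i) ∂(Measure.pi fun _ : A => ρ)) *
        ∏ j, ∫ z, φ (e (Sum.inr j)) z ∂ρ := by
  have h := slab_integral_pi_window ρ e φ f (fun _ => 1)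
  have h2 : ∫ z : B → Y, ∏ j, φ (e (Sum.inr j)) (z j) ∂(Measure.pi fun _ : B => ρ) =
      ∏ j, ∫ z, φ (e (Sum.inr j)) z ∂ρ :=
    integral_fintype_prod_eq_prod _
  simp only [mul_one, one_mul] at h
  rw [h2] at h
  exact h

/-- **Two windows and free fibres**: along `e : A ⊕ (B ⊕ C) ≃ ι`,
`∫ f(γ ∘ e ∘ inl) g(γ ∘ e ∘ inr ∘ inl) ∏ₜ φₜ(γₜ) dρ^{⊗ι} = (∫ f ∏ φ dρ^{⊗A}) ((∫ g ∏ φ dρ^{⊗B}) ∏_{j : C} ∫ φ_{e(inr (inr j))} dρ)`.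
[folklore] -/
theorem slab_integral_pi_window_two {A B C ι : Type*} [Fintype A] [Fintype B] [Fintype C] [Fintype ι]
    (ρ : Measure Y) [SigmaFinite ρ] (e : A ⊕ (B ⊕ C) ≃ ι) (φ : ι → Y → ℝ) (f : (A → Y) → ℝ)
    (g : (B → Y) → ℝ) :
    ∫ x, f (fun i => x (e (Sum.inl i))) * g (fun i => x (e (Sum.inr (Sum.inl i)))) * ∏ t, φ t (x t)
        ∂(Measure.pi fun _ : ι => ρ) =
      (∫ y, f y * ∏ i, φ (e (Sum.inl i)) (y i) ∂(Measure.pi fun _ : A => ρ)) *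
        ((∫ y, g y * ∏ i, φ (e (Sum.inr (Sum.inl i))) (y i) ∂(Measure.pi fun _ : B => ρ)) *
          ∏ j, ∫ z, φ (e (Sum.inr (Sum.inr j))) z ∂ρ) := by
  refine (slab_integral_pi_window ρ e φ f (fun x' : B ⊕ C → Y => g fun i => x' (Sum.inl i))).trans ?_
  congr 1
  have h := slab_integral_pi_window_one ρ (Equiv.refl (B ⊕ C)) (fun j => φ (e (Sum.inr j))) g
  simp only [Equiv.refl_apply] at h
  exact h

/-- **Outer block versus inner block**: for a bounded measurable `G` and `e : A ⊕ B ≃ ι`,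
`∫ G dρ^{⊗ι} = ∫ (∫ G((W ⊔ v) ∘ e⁻¹) dρ^{⊗B}(v)) dρ^{⊗A}(W)`. [folklore] -/
theorem slab_integral_pi_split {A B ι : Type*} [Fintype A] [Fintype B] [Fintype ι] (ρ : Measure Y)
    [IsFiniteMeasure ρ] (e : A ⊕ B ≃ ι) {G : (ι → Y) → ℝ} (hG : Measurable G) {C : ℝ}
    (hGb : ∀ x, ‖G x‖ ≤ C) :
    ∫ x, G x ∂(Measure.pi fun _ : ι => ρ) =
      ∫ W, ∫ v, G (fun t => Sum.elim W v (e.symm t)) ∂(Measure.pi fun _ : B => ρ)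
        ∂(Measure.pi fun _ : A => ρ) := by
  rw [slab_integral_pi_relabel ρ e]
  have hm : Measurable fun V : A ⊕ B → Y => fun t => V (e.symm t) :=
    measurable_pi_lambda _ fun t => measurable_pi_apply _
  exact slab_integral_pi_sum_fubini ρ (hG.comp hm) (fun V => hGb _)

end Windows

section Cyclic

variable {X Γ : Type*} [MeasurableSpace X] [MeasurableSpace Γ] {μ : Measure X} {ν : Measure Γ}
  [IsProbabilityMeasure μ] [IsProbabilityMeasure ν] {c : X → Γ → X → ℝ} {Cc : ℝ}

/-- Successor arithmetic of the labelling `Fin (k+1) → ZMod N`, `t ↦ t (mod N)`, for `N = k + 1`. [folklore] -/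
theorem slab_cast_add_one {N k : ℕ} (hN : N = k + 1) (t : Fin (k + 1)) :
    ((t : ℕ) : ZMod N) + 1 = (((t + 1 : Fin (k + 1)) : ℕ) : ZMod N) := by
  rw [Fin.val_add_one]
  split_ifs with h
  · rw [h, Fin.val_last, ← Nat.cast_add_one, ← hN, ZMod.natCast_self, Nat.cast_zero]
  · push_cast; ring

/-- **(e) No block inserted: fibre integration and relabelling.**
`∫ ∏ₜ c(xₜ, γₜ, xₜ₊₁) d(μ^{⊗ℤ/N} ⊗ ν^{⊗ℤ/N}) = ∫ ∏ₜ K(Vₜ, Vₜ₊₁) dμ^{⊗ Fin N}` (Fubini, `integral_fintype_prod_eq_prod`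
on the fibres, relabelling `Fin N ≃ ZMod N`). [folklore] -/
theorem slab_cyclic_zero (hc : Measurable (fun q : X × Γ × X => c q.1 q.2.1 q.2.2))
    (hcb : ∀ x γ x', 0 ≤ c x γ x' ∧ c x γ x' ≤ Cc) {N k : ℕ} [NeZero N] (hN : N = k + 1) :
    ∫ p : (ZMod N → X) × (ZMod N → Γ), ∏ t : ZMod N, c (p.1 t) (p.2 t) (p.1 (t + 1))
        ∂((Measure.pi fun _ => μ).prod (Measure.pi fun _ => ν)) =
      ∫ V : Fin (k + 1) → X, ∏ t : Fin (k + 1), (∫ γ, c (V t) γ (V (t + 1)) ∂ν) ∂(Measure.pi fun _ => μ) := by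
  have hFm : Measurable fun p : (ZMod N → X) × (ZMod N → Γ) =>
      ∏ t : ZMod N, c (p.1 t) (p.2 t) (p.1 (t + 1)) := by
    refine Finset.measurable_prod _ fun t _ => ?_
    have h1 : Measurable fun p : (ZMod N → X) × (ZMod N → Γ) => p.1 t :=
      (measurable_pi_apply t).comp measurable_fst
    have h2 : Measurable fun p : (ZMod N → X) × (ZMod N → Γ) => p.2 t :=
      (measurable_pi_apply t).comp measurable_snd
    have h3 : Measurable fun p : (ZMod N → X) × (ZMod N → Γ) => p.1 (t + 1) :=
      (measurable_pi_apply (t + 1)).comp measurable_fst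
    exact hc.comp (h1.prodMk (h2.prodMk h3))
  have hFb : ∀ p : (ZMod N → X) × (ZMod N → Γ),
      ‖∏ t : ZMod N, c (p.1 t) (p.2 t) (p.1 (t + 1))‖ ≤ Cc ^ N := fun p => by
    rw [Real.norm_eq_abs, abs_of_nonneg (Finset.prod_nonneg fun t _ => (hcb _ _ _).1)]
    calc _ ≤ ∏ _t : ZMod N, Cc := Finset.prod_le_prod (fun t _ => (hcb _ _ _).1) fun t _ => (hcb _ _ _).2
      _ = Cc ^ N := by simp [ZMod.card]
  have hint : Integrable (fun p : (ZMod N → X) × (ZMod N → Γ) =>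
      ∏ t : ZMod N, c (p.1 t) (p.2 t) (p.1 (t + 1))) ((Measure.pi fun _ => μ).prod (Measure.pi fun _ => ν)) :=
    Integrable.of_bound hFm.aestronglyMeasurable _ (Eventually.of_forall hFb)
  rw [integral_prod _ hint]
  dsimp only
  have hfib : ∀ x : ZMod N → X, ∫ γ : ZMod N → Γ, ∏ t : ZMod N, c (x t) (γ t) (x (t + 1))
      ∂(Measure.pi fun _ => ν) = ∏ t : ZMod N, ∫ γ, c (x t) γ (x (t + 1)) ∂ν := fun x =>
    integral_fintype_prod_eq_prod (fun t γ => c (x t) γ (x (t + 1)))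
  simp_rw [hfib]
  obtain ⟨e, he⟩ := slab_zmod_equiv (N := N) (fun t : Fin (k + 1) => (t : ℕ)) (fun t => by omega)
    (fun t t' h => Fin.ext h) (by simp [hN])
  rw [slab_integral_pi_relabel μ e]
  refine integral_congr_ae (Eventually.of_forall fun V => ?_)
  dsimp only
  calc ∏ t : ZMod N, ∫ γ, c (V (e.symm t)) γ (V (e.symm (t + 1))) ∂ν
      = ∏ s : Fin (k + 1), ∫ γ, c (V (e.symm (e s))) γ (V (e.symm (e s + 1))) ∂ν :=
        (Fintype.prod_equiv e _ _ (fun s => rfl)).symm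
    _ = ∏ s : Fin (k + 1), ∫ γ, c (V s) γ (V (s + 1)) ∂ν :=
        Fintype.prod_congr _ _ fun s => by
          rw [he s, slab_cast_add_one hN s, ← he (s + 1), ← he s, e.symm_apply_apply, e.symm_apply_apply]

/-- **(d) One block inserted: fibre integration, then contraction of the block interior.**  With the window
`A` at the sites `0, …, r+1` (fibres `0, …, r`) of the cycle `ℤ/N`, `N = M + r + 2`:
`∫ α(x_A, γ_A) ∏ₜ c(xₜ, γₜ, xₜ₊₁) d(μ^{⊗N} ⊗ ν^{⊗N}) = ∫ X_α(V 0, V 1) ∏_{t=1}^{M+1} K(V t, V (t+1)) dμ^{⊗(1+M+1)}(V)`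
(the one-insertion shape of `integral_cyclic_insert_one`).  The fibres are integrated along the labelling
`Fin (r+1) ⊕ Fin (1+M) ≃ ZMod N` (window fibres, free bonds `r+1+t`), the sites along
`Fin (1+M+1) ⊕ Fin r ≃ ZMod N` (outer sites `0 ↦ 0`, `s ↦ r+s`; interior `j ↦ j+1`). [folklore] -/
theorem slab_cyclic_one (hc : Measurable (fun q : X × Γ × X => c q.1 q.2.1 q.2.2))
    (hcb : ∀ x γ x', 0 ≤ c x γ x' ∧ c x γ x' ≤ Cc) {r : ℕ} {α : (Fin (r + 2) → X) → (Fin (r + 1) → Γ) → ℝ}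
    {Cα : ℝ} (hα : Measurable (fun q : (Fin (r + 2) → X) × (Fin (r + 1) → Γ) => α q.1 q.2))
    (hαb : ∀ W γs, |α W γs| ≤ Cα) {N M : ℕ} [NeZero N] (hN : N = M + r + 2) :
    ∫ p : (ZMod N → X) × (ZMod N → Γ),
        α (fun i : Fin (r + 2) => p.1 ((i : ℕ) : ZMod N)) (fun i : Fin (r + 1) => p.2 ((i : ℕ) : ZMod N)) *
          ∏ t : ZMod N, c (p.1 t) (p.2 t) (p.1 (t + 1))
        ∂((Measure.pi fun _ => μ).prod (Measure.pi fun _ => ν)) =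
      ∫ V : Fin (1 + M + 1) → X, (fun u u' : X => ∫ v : Fin r → X, ∫ γs : Fin (r + 1) → Γ,
          α (Fin.cons u (Fin.snoc v u')) γs * ∏ i : Fin (r + 1),
            c ((Fin.cons u (Fin.snoc v u') : Fin (r + 2) → X) (Fin.castSucc i)) (γs i)
              ((Fin.cons u (Fin.snoc v u') : Fin (r + 2) → X) (Fin.succ i)) ∂(Measure.pi fun _ => ν)
          ∂(Measure.pi fun _ => μ)) (V 0) (V 1) *
        ∏ t : Fin (1 + M), (∫ γ, c (V t.succ) γ (V (t.succ + 1)) ∂ν) ∂(Measure.pi fun _ => μ) := by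
  -- Step 1: Fubini, slices versus fibres
  have hPm : Measurable fun p : (ZMod N → X) × (ZMod N → Γ) =>
      ∏ t : ZMod N, c (p.1 t) (p.2 t) (p.1 (t + 1)) := by
    refine Finset.measurable_prod _ fun t _ => ?_
    have h1 : Measurable fun p : (ZMod N → X) × (ZMod N → Γ) => p.1 t :=
      (measurable_pi_apply t).comp measurable_fst
    have h2 : Measurable fun p : (ZMod N → X) × (ZMod N → Γ) => p.2 t :=
      (measurable_pi_apply t).comp measurable_snd
    have h3 : Measurable fun p : (ZMod N → X) × (ZMod N → Γ) => p.1 (t + 1) :=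
      (measurable_pi_apply (t + 1)).comp measurable_fst
    exact hc.comp (h1.prodMk (h2.prodMk h3))
  have hP0 : ∀ p : (ZMod N → X) × (ZMod N → Γ), 0 ≤ ∏ t : ZMod N, c (p.1 t) (p.2 t) (p.1 (t + 1)) :=
    fun p => Finset.prod_nonneg fun t _ => (hcb _ _ _).1
  have hPb : ∀ p : (ZMod N → X) × (ZMod N → Γ), ∏ t : ZMod N, c (p.1 t) (p.2 t) (p.1 (t + 1)) ≤ Cc ^ N :=
    fun p => calc
      _ ≤ ∏ _t : ZMod N, Cc := Finset.prod_le_prod (fun t _ => (hcb _ _ _).1) fun t _ => (hcb _ _ _).2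
      _ = Cc ^ N := by simp [ZMod.card]
  have hWm : Measurable fun p : (ZMod N → X) × (ZMod N → Γ) =>
      α (fun i : Fin (r + 2) => p.1 ((i : ℕ) : ZMod N)) (fun i : Fin (r + 1) => p.2 ((i : ℕ) : ZMod N)) := by
    have h1 : Measurable fun p : (ZMod N → X) × (ZMod N → Γ) => fun i : Fin (r + 2) => p.1 ((i : ℕ) : ZMod N) :=
      measurable_pi_lambda _ fun i => (measurable_pi_apply _).comp measurable_fst
    have h2 : Measurable fun p : (ZMod N → X) × (ZMod N → Γ) => fun i : Fin (r + 1) => p.2 ((i : ℕ) : ZMod N) :=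
      measurable_pi_lambda _ fun i => (measurable_pi_apply _).comp measurable_snd
    exact hα.comp (h1.prodMk h2)
  have hint : Integrable (fun p : (ZMod N → X) × (ZMod N → Γ) =>
      α (fun i : Fin (r + 2) => p.1 ((i : ℕ) : ZMod N)) (fun i : Fin (r + 1) => p.2 ((i : ℕ) : ZMod N)) *
        ∏ t : ZMod N, c (p.1 t) (p.2 t) (p.1 (t + 1))) ((Measure.pi fun _ => μ).prod (Measure.pi fun _ => ν)) := by
    refine Integrable.of_bound (hWm.mul hPm).aestronglyMeasurable (Cα * Cc ^ N)
      (Eventually.of_forall fun p => ?_)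
    rw [norm_mul, Real.norm_eq_abs, Real.norm_eq_abs, abs_of_nonneg (hP0 p)]
    have h0 : 0 ≤ Cα := (abs_nonneg _).trans (hαb (fun i : Fin (r + 2) => p.1 ((i : ℕ) : ZMod N))
      (fun i : Fin (r + 1) => p.2 ((i : ℕ) : ZMod N)))
    exact mul_le_mul (hαb _ _) (hPb p) (hP0 p) h0
  rw [integral_prod _ hint]
  dsimp only
  -- Step 2: fibre integration, pointwise in the slices
  obtain ⟨ef, hef⟩ := slab_zmod_equiv (N := N)
    (Sum.elim (fun i : Fin (r + 1) => (i : ℕ)) (fun t : Fin (1 + M) => r + 1 + (t : ℕ)))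
    (by
      rintro (i | t)
      · simp only [Sum.elim_inl]; have := i.isLt; omega
      · simp only [Sum.elim_inr]; have := t.isLt; omega)
    (by
      rintro (i | t) (i' | t') h <;> simp only [Sum.elim_inl, Sum.elim_inr] at h
      · exact congrArg Sum.inl (Fin.ext h)
      · exfalso; have := i.isLt; omega
      · exfalso; have := i'.isLt; omega
      · exact congrArg Sum.inr (Fin.ext (by omega)))
    (by simp only [Fintype.card_sum, Fintype.card_fin]; omega)
  have hfib : ∀ x : ZMod N → X,
      ∫ γ : ZMod N → Γ, α (fun i : Fin (r + 2) => x ((i : ℕ) : ZMod N))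
          (fun i : Fin (r + 1) => γ ((i : ℕ) : ZMod N)) * ∏ t : ZMod N, c (x t) (γ t) (x (t + 1))
          ∂(Measure.pi fun _ => ν) =
        (∫ γs : Fin (r + 1) → Γ, α (fun i : Fin (r + 2) => x ((i : ℕ) : ZMod N)) γs *
            ∏ i : Fin (r + 1), c ((fun i : Fin (r + 2) => x ((i : ℕ) : ZMod N)) (Fin.castSucc i)) (γs i)
              ((fun i : Fin (r + 2) => x ((i : ℕ) : ZMod N)) (Fin.succ i)) ∂(Measure.pi fun _ => ν)) *
          ∏ t : Fin (1 + M), ∫ γ, c (x ((r + 1 + (t : ℕ) : ℕ) : ZMod N)) γ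
            (x (((r + 1 + (t : ℕ) : ℕ) : ZMod N) + 1)) ∂ν := by
    intro x
    have h := slab_integral_pi_window_one ν ef (fun t γ => c (x t) γ (x (t + 1)))
      (α fun i : Fin (r + 2) => x ((i : ℕ) : ZMod N))
    simp only [hef, Sum.elim_inl, Sum.elim_inr] at h
    rw [h]
    congr 1
    refine integral_congr_ae (Eventually.of_forall fun γs => ?_)
    dsimp only
    congr 1
    refine Fintype.prod_congr _ _ fun i => ?_
    simp only [Fin.val_castSucc, Fin.val_succ, Nat.cast_succ]
  refine (integral_congr_ae (Eventually.of_forall fun x => hfib x)).trans ?_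
  -- Step 3: contraction of the block interior
  obtain ⟨es, hes⟩ := slab_zmod_equiv (N := N)
    (Sum.elim (fun s : Fin (1 + M + 1) => if (s : ℕ) = 0 then 0 else r + (s : ℕ)) (fun j : Fin r => (j : ℕ) + 1))
    (by
      rintro (s | j)
      · simp only [Sum.elim_inl]; have := s.isLt; split_ifs <;> omega
      · simp only [Sum.elim_inr]; have := j.isLt; omega)
    (by
      rintro (s | j) (s' | j') h <;> simp only [Sum.elim_inl, Sum.elim_inr] at h
      · refine congrArg Sum.inl (Fin.ext ?_); split_ifs at h <;> omega
      · exfalso; have := j'.isLt; split_ifs at h; omega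
      · exfalso; have := j.isLt; split_ifs at h; omega
      · exact congrArg Sum.inr (Fin.ext (by omega)))
    (by simp only [Fintype.card_sum, Fintype.card_fin]; omega)
  have hΨm := slab_blockWeight_measurable (ν := ν) hc hα
  have hKm := slab_kernel_measurable (ν := ν) hc
  have hGm : Measurable fun x : ZMod N → X =>
      (∫ γs : Fin (r + 1) → Γ, α (fun i : Fin (r + 2) => x ((i : ℕ) : ZMod N)) γs *
          ∏ i : Fin (r + 1), c ((fun i : Fin (r + 2) => x ((i : ℕ) : ZMod N)) (Fin.castSucc i)) (γs i)
            ((fun i : Fin (r + 2) => x ((i : ℕ) : ZMod N)) (Fin.succ i)) ∂(Measure.pi fun _ => ν)) *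
        ∏ t : Fin (1 + M), ∫ γ, c (x ((r + 1 + (t : ℕ) : ℕ) : ZMod N)) γ
          (x (((r + 1 + (t : ℕ) : ℕ) : ZMod N) + 1)) ∂ν := by
    refine Measurable.mul ?_ (Finset.measurable_prod _ fun t _ => ?_)
    · exact hΨm.comp (measurable_pi_lambda _ fun i : Fin (r + 2) => measurable_pi_apply (((i : ℕ) : ZMod N)))
    · have h1 : Measurable fun x : ZMod N → X => x ((r + 1 + (t : ℕ) : ℕ) : ZMod N) := measurable_pi_apply _
      have h2 : Measurable fun x : ZMod N → X => x ((((r + 1 + (t : ℕ) : ℕ)) : ZMod N) + 1) :=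
        measurable_pi_apply _
      exact hKm.comp (h1.prodMk h2)
  have hGb : ∀ x : ZMod N → X,
      ‖(∫ γs : Fin (r + 1) → Γ, α (fun i : Fin (r + 2) => x ((i : ℕ) : ZMod N)) γs *
          ∏ i : Fin (r + 1), c ((fun i : Fin (r + 2) => x ((i : ℕ) : ZMod N)) (Fin.castSucc i)) (γs i)
            ((fun i : Fin (r + 2) => x ((i : ℕ) : ZMod N)) (Fin.succ i)) ∂(Measure.pi fun _ => ν)) *
        ∏ t : Fin (1 + M), ∫ γ, c (x ((r + 1 + (t : ℕ) : ℕ) : ZMod N)) γ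
          (x (((r + 1 + (t : ℕ) : ℕ) : ZMod N) + 1)) ∂ν‖ ≤ Cα * Cc ^ (r + 1) * Cc ^ (1 + M) := fun x => by
    rw [norm_mul, Real.norm_eq_abs, Real.norm_eq_abs]
    have hA := slab_blockWeight_abs_le' (ν := ν) hc hcb hαb (fun i : Fin (r + 2) => x ((i : ℕ) : ZMod N))
    have hR0 : 0 ≤ ∏ t : Fin (1 + M), ∫ γ, c (x ((r + 1 + (t : ℕ) : ℕ) : ZMod N)) γ
        (x (((r + 1 + (t : ℕ) : ℕ) : ZMod N) + 1)) ∂ν :=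
      Finset.prod_nonneg fun t _ => (slab_kernel_bounds hcb _ _).1
    have hRb : ∏ t : Fin (1 + M), ∫ γ, c (x ((r + 1 + (t : ℕ) : ℕ) : ZMod N)) γ
        (x (((r + 1 + (t : ℕ) : ℕ) : ZMod N) + 1)) ∂ν ≤ Cc ^ (1 + M) :=
      calc _ ≤ ∏ _t : Fin (1 + M), Cc := Finset.prod_le_prod (fun t _ => (slab_kernel_bounds hcb _ _).1)
              fun t _ => (slab_kernel_bounds hcb _ _).2
        _ = Cc ^ (1 + M) := by simp
    rw [abs_of_nonneg hR0]
    exact mul_le_mul hA hRb hR0 ((abs_nonneg _).trans hA)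
  refine (slab_integral_pi_split μ es hGm hGb).trans ?_
  refine integral_congr_ae (Eventually.of_forall fun W => ?_)
  -- Step 4: identification of the sites
  have hv1 : ((1 : Fin (1 + M + 1)) : ℕ) = 1 := by
    rw [Fin.val_one', Nat.mod_eq_of_lt (by omega)]
  have hA' : ∀ (v : Fin r → X) (i : Fin (r + 2)),
      Sum.elim W v (es.symm ((i : ℕ) : ZMod N)) = (Fin.cons (W 0) (Fin.snoc v (W 1)) : Fin (r + 2) → X) i := by
    intro v i
    refine Fin.cases ?_ (fun j => ?_) i
    · have h : es.symm (((0 : Fin (r + 2)) : ℕ) : ZMod N) = Sum.inl 0 := by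
        rw [Equiv.symm_apply_eq, hes, Sum.elim_inl]; simp
      rw [h, Sum.elim_inl, Fin.cons_zero]
    · rw [Fin.cons_succ]
      refine Fin.lastCases ?_ (fun j' => ?_) j
      · have h : es.symm ((((Fin.last r).succ : Fin (r + 2)) : ℕ) : ZMod N) = Sum.inl 1 := by
          rw [Equiv.symm_apply_eq, hes, Sum.elim_inl, hv1, if_neg one_ne_zero]; simp
        rw [h, Sum.elim_inl, Fin.snoc_last]
      · have h : es.symm (((j'.castSucc.succ : Fin (r + 2)) : ℕ) : ZMod N) = Sum.inr j' := by
          rw [Equiv.symm_apply_eq, hes, Sum.elim_inr]; simp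
        rw [h, Sum.elim_inr, Fin.snoc_castSucc]
  have hR1 : ∀ (v : Fin r → X) (t : Fin (1 + M)),
      Sum.elim W v (es.symm ((r + 1 + (t : ℕ) : ℕ) : ZMod N)) = W t.succ := by
    intro v t
    have h : es.symm (((r + 1 + (t : ℕ) : ℕ)) : ZMod N) = Sum.inl t.succ := by
      rw [Equiv.symm_apply_eq, hes, Sum.elim_inl, Fin.val_succ, if_neg (Nat.add_one_ne_zero _)]
      congr 1; omega
    rw [h, Sum.elim_inl]
  have hR2 : ∀ (v : Fin r → X) (t : Fin (1 + M)),
      Sum.elim W v (es.symm ((((r + 1 + (t : ℕ) : ℕ)) : ZMod N) + 1)) = W (t.succ + 1) := by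
    intro v t
    have h : es.symm ((((r + 1 + (t : ℕ) : ℕ)) : ZMod N) + 1) = Sum.inl (t.succ + 1) := by
      rw [Equiv.symm_apply_eq, hes, Sum.elim_inl, Fin.val_add_one]
      by_cases ht : t.succ = Fin.last (1 + M)
      · have hv := congrArg Fin.val ht
        rw [Fin.val_succ, Fin.val_last] at hv
        rw [if_pos ht, if_pos rfl, ← Nat.cast_add_one, show r + 1 + (t : ℕ) + 1 = N by omega,
          ZMod.natCast_self, Nat.cast_zero]
      · rw [if_neg ht, Fin.val_succ, if_neg (Nat.add_one_ne_zero _)]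
        push_cast; ring
    rw [h, Sum.elim_inl]
  simp only [hA', hR1, hR2]
  exact integral_mul_const _ _

/-- **(c) Two blocks inserted: fibre integration, then contraction of both block interiors.**  Windows `A` at the
sites `0, …, r+1` and `B` at the sites `r+a+3, …, 2r+a+4` of the cycle `ℤ/N`, `N = 2r + a + b' + 6`:
the cyclic integral of `α(x_A, γ_A) β(x_B, γ_B) ∏ₜ c(xₜ, γₜ, xₜ₊₁)` equals the heterogeneous cyclic integral on
`Fin (a + b' + 6)` with the bond kernels `X_α` (bond `0`), `X_β` (bond `a+3`) and `K` elsewhere (the two-insertion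
shape of `integral_cyclic_insert_two (a := a+2) (b' := b'+1)`).  The fibres are integrated along the labelling
`Fin (r+1) ⊕ (Fin (r+1) ⊕ C) ≃ ZMod N` and the sites along `Fin (a+b'+6) ⊕ (Fin r ⊕ Fin r) ≃ ZMod N`, where
`C = {s : Fin (a+b'+6) // s ≠ 0, a+3}` indexes the free bonds and the outer site `s` sits at `0`, `r + s`
(`1 ≤ s ≤ a+3`) or `2r + s` (`s ≥ a+4`). [folklore] -/
theorem slab_cyclic_two (hc : Measurable (fun q : X × Γ × X => c q.1 q.2.1 q.2.2))
    (hcb : ∀ x γ x', 0 ≤ c x γ x' ∧ c x γ x' ≤ Cc) {r : ℕ}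
    {α β : (Fin (r + 2) → X) → (Fin (r + 1) → Γ) → ℝ} {Cα Cβ : ℝ}
    (hα : Measurable (fun q : (Fin (r + 2) → X) × (Fin (r + 1) → Γ) => α q.1 q.2))
    (hβ : Measurable (fun q : (Fin (r + 2) → X) × (Fin (r + 1) → Γ) => β q.1 q.2))
    (hαb : ∀ W γs, |α W γs| ≤ Cα) (hβb : ∀ W γs, |β W γs| ≤ Cβ) {a b' N : ℕ} [NeZero N]
    (hN : N = 2 * r + a + b' + 4 + 2) :
    ∫ p : (ZMod N → X) × (ZMod N → Γ),
        α (fun i : Fin (r + 2) => p.1 ((i : ℕ) : ZMod N)) (fun i : Fin (r + 1) => p.2 ((i : ℕ) : ZMod N)) *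
          β (fun i : Fin (r + 2) => p.1 ((r + a + 3 + (i : ℕ) : ℕ) : ZMod N))
            (fun i : Fin (r + 1) => p.2 ((r + a + 3 + (i : ℕ) : ℕ) : ZMod N)) *
          ∏ t : ZMod N, c (p.1 t) (p.2 t) (p.1 (t + 1))
        ∂((Measure.pi fun _ => μ).prod (Measure.pi fun _ => ν)) =
      ∫ V : Fin (1 + (a + 2 + (b' + 1 + 1)) + 1) → X, ∏ t : Fin (1 + (a + 2 + (b' + 1 + 1)) + 1),
        (fun s : ℕ => if s = 0 then (fun u u' : X => ∫ v : Fin r → X, ∫ γs : Fin (r + 1) → Γ,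
          α (Fin.cons u (Fin.snoc v u')) γs * ∏ i : Fin (r + 1),
            c ((Fin.cons u (Fin.snoc v u') : Fin (r + 2) → X) (Fin.castSucc i)) (γs i)
              ((Fin.cons u (Fin.snoc v u') : Fin (r + 2) → X) (Fin.succ i)) ∂(Measure.pi fun _ => ν)
          ∂(Measure.pi fun _ => μ))
          else if s = a + 2 + 1 then (fun u u' : X => ∫ v : Fin r → X, ∫ γs : Fin (r + 1) → Γ,
          β (Fin.cons u (Fin.snoc v u')) γs * ∏ i : Fin (r + 1),
            c ((Fin.cons u (Fin.snoc v u') : Fin (r + 2) → X) (Fin.castSucc i)) (γs i)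
              ((Fin.cons u (Fin.snoc v u') : Fin (r + 2) → X) (Fin.succ i)) ∂(Measure.pi fun _ => ν)
          ∂(Measure.pi fun _ => μ))
          else fun x x' : X => ∫ γ, c (x) γ (x') ∂ν) (t : ℕ) (V t) (V (t + 1)) ∂(Measure.pi fun _ => μ) := by
  -- the outer cycle `Fin NN`, `NN = a + b' + 6`, the start `c3` of the contracted block `B`, the free bonds `C`
  obtain ⟨c3, hvc3⟩ : ∃ c3 : Fin (1 + (a + 2 + (b' + 1 + 1)) + 1), (c3 : ℕ) = a + 2 + 1 :=
    ⟨⟨a + 2 + 1, by omega⟩, rfl⟩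
  have hvc4 : ((c3 + 1 : Fin (1 + (a + 2 + (b' + 1 + 1)) + 1)) : ℕ) = a + 2 + 1 + 1 := by
    rw [Fin.val_add_one, if_neg, hvc3]
    intro h
    have := congrArg Fin.val h
    rw [hvc3, Fin.val_last] at this
    omega
  have hv1 : ((1 : Fin (1 + (a + 2 + (b' + 1 + 1)) + 1)) : ℕ) = 1 := by
    rw [Fin.val_one', Nat.mod_eq_of_lt (by omega)]
  have hmem : ∀ x : Fin (1 + (a + 2 + (b' + 1 + 1)) + 1),
      x ∈ ({0, c3} : Finset (Fin (1 + (a + 2 + (b' + 1 + 1)) + 1))) ↔ (x : ℕ) = 0 ∨ (x : ℕ) = a + 2 + 1 := by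
    intro x
    rw [Finset.mem_insert, Finset.mem_singleton, Fin.ext_iff, Fin.ext_iff, Fin.val_zero, hvc3]
  have h0c3 : (0 : Fin (1 + (a + 2 + (b' + 1 + 1)) + 1)) ≠ c3 := by
    intro h
    have := congrArg Fin.val h
    rw [Fin.val_zero, hvc3] at this
    omega
  have hcardC : Fintype.card {s : Fin (1 + (a + 2 + (b' + 1 + 1)) + 1) // ¬((s : ℕ) = 0 ∨ (s : ℕ) = a + 2 + 1)} =
      1 + (a + 2 + (b' + 1 + 1)) + 1 - 2 := by
    rw [Fintype.card_subtype_compl, Fintype.card_fin,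
      Fintype.card_of_subtype ({0, c3} : Finset (Fin (1 + (a + 2 + (b' + 1 + 1)) + 1))) hmem,
      Finset.card_pair h0c3]
  -- Step 1: Fubini, slices versus fibres
  have hPm : Measurable fun p : (ZMod N → X) × (ZMod N → Γ) =>
      ∏ t : ZMod N, c (p.1 t) (p.2 t) (p.1 (t + 1)) := by
    refine Finset.measurable_prod _ fun t _ => ?_
    have h1 : Measurable fun p : (ZMod N → X) × (ZMod N → Γ) => p.1 t :=
      (measurable_pi_apply t).comp measurable_fst
    have h2 : Measurable fun p : (ZMod N → X) × (ZMod N → Γ) => p.2 t :=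
      (measurable_pi_apply t).comp measurable_snd
    have h3 : Measurable fun p : (ZMod N → X) × (ZMod N → Γ) => p.1 (t + 1) :=
      (measurable_pi_apply (t + 1)).comp measurable_fst
    exact hc.comp (h1.prodMk (h2.prodMk h3))
  have hP0 : ∀ p : (ZMod N → X) × (ZMod N → Γ), 0 ≤ ∏ t : ZMod N, c (p.1 t) (p.2 t) (p.1 (t + 1)) :=
    fun p => Finset.prod_nonneg fun t _ => (hcb _ _ _).1
  have hPb : ∀ p : (ZMod N → X) × (ZMod N → Γ), ∏ t : ZMod N, c (p.1 t) (p.2 t) (p.1 (t + 1)) ≤ Cc ^ N :=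
    fun p => calc
      _ ≤ ∏ _t : ZMod N, Cc := Finset.prod_le_prod (fun t _ => (hcb _ _ _).1) fun t _ => (hcb _ _ _).2
      _ = Cc ^ N := by simp [ZMod.card]
  have hWm : Measurable fun p : (ZMod N → X) × (ZMod N → Γ) =>
      α (fun i : Fin (r + 2) => p.1 ((i : ℕ) : ZMod N)) (fun i : Fin (r + 1) => p.2 ((i : ℕ) : ZMod N)) *
        β (fun i : Fin (r + 2) => p.1 ((r + a + 3 + (i : ℕ) : ℕ) : ZMod N))
          (fun i : Fin (r + 1) => p.2 ((r + a + 3 + (i : ℕ) : ℕ) : ZMod N)) := by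
    have h1 : Measurable fun p : (ZMod N → X) × (ZMod N → Γ) => fun i : Fin (r + 2) => p.1 ((i : ℕ) : ZMod N) :=
      measurable_pi_lambda _ fun i => (measurable_pi_apply _).comp measurable_fst
    have h2 : Measurable fun p : (ZMod N → X) × (ZMod N → Γ) => fun i : Fin (r + 1) => p.2 ((i : ℕ) : ZMod N) :=
      measurable_pi_lambda _ fun i => (measurable_pi_apply _).comp measurable_snd
    have h3 : Measurable fun p : (ZMod N → X) × (ZMod N → Γ) =>
        fun i : Fin (r + 2) => p.1 ((r + a + 3 + (i : ℕ) : ℕ) : ZMod N) :=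
      measurable_pi_lambda _ fun i => (measurable_pi_apply _).comp measurable_fst
    have h4 : Measurable fun p : (ZMod N → X) × (ZMod N → Γ) =>
        fun i : Fin (r + 1) => p.2 ((r + a + 3 + (i : ℕ) : ℕ) : ZMod N) :=
      measurable_pi_lambda _ fun i => (measurable_pi_apply _).comp measurable_snd
    exact (hα.comp (h1.prodMk h2)).mul (hβ.comp (h3.prodMk h4))
  have hint : Integrable (fun p : (ZMod N → X) × (ZMod N → Γ) =>
      α (fun i : Fin (r + 2) => p.1 ((i : ℕ) : ZMod N)) (fun i : Fin (r + 1) => p.2 ((i : ℕ) : ZMod N)) *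
        β (fun i : Fin (r + 2) => p.1 ((r + a + 3 + (i : ℕ) : ℕ) : ZMod N))
          (fun i : Fin (r + 1) => p.2 ((r + a + 3 + (i : ℕ) : ℕ) : ZMod N)) *
        ∏ t : ZMod N, c (p.1 t) (p.2 t) (p.1 (t + 1))) ((Measure.pi fun _ => μ).prod (Measure.pi fun _ => ν)) := by
    refine Integrable.of_bound (hWm.mul hPm).aestronglyMeasurable (Cα * Cβ * Cc ^ N)
      (Eventually.of_forall fun p => ?_)
    rw [norm_mul, norm_mul, Real.norm_eq_abs, Real.norm_eq_abs, Real.norm_eq_abs, abs_of_nonneg (hP0 p)]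
    have h0 : 0 ≤ Cα := (abs_nonneg _).trans (hαb (fun i : Fin (r + 2) => p.1 ((i : ℕ) : ZMod N))
      (fun i : Fin (r + 1) => p.2 ((i : ℕ) : ZMod N)))
    have h0' : 0 ≤ Cβ := (abs_nonneg _).trans (hβb (fun i : Fin (r + 2) => p.1 ((r + a + 3 + (i : ℕ) : ℕ) : ZMod N))
      (fun i : Fin (r + 1) => p.2 ((r + a + 3 + (i : ℕ) : ℕ) : ZMod N)))
    exact mul_le_mul (mul_le_mul (hαb _ _) (hβb _ _) (abs_nonneg _) h0) (hPb p) (hP0 p) (mul_nonneg h0 h0')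
  rw [integral_prod _ hint]
  dsimp only
  -- Step 2: fibre integration, pointwise in the slices
  obtain ⟨ef, hef⟩ := slab_zmod_equiv (N := N)
    (Sum.elim (fun i : Fin (r + 1) => (i : ℕ))
      (Sum.elim (fun i : Fin (r + 1) => r + a + 3 + (i : ℕ))
        (fun s : {s : Fin (1 + (a + 2 + (b' + 1 + 1)) + 1) // ¬((s : ℕ) = 0 ∨ (s : ℕ) = a + 2 + 1)} =>
          if (s.1 : ℕ) = 0 then 0 else if (s.1 : ℕ) ≤ a + 3 then r + (s.1 : ℕ) else 2 * r + (s.1 : ℕ))))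
    (by
      rintro (i | i | s)
      · simp only [Sum.elim_inl]; have := i.isLt; omega
      · simp only [Sum.elim_inr, Sum.elim_inl]; have := i.isLt; omega
      · simp only [Sum.elim_inr]; have := s.1.isLt; split_ifs <;> omega)
    (by
      rintro (i | i | s) (i' | i' | s') h <;> simp only [Sum.elim_inl, Sum.elim_inr] at h
      · exact congrArg Sum.inl (Fin.ext h)
      · exfalso; have := i.isLt; omega
      · exfalso; have := i.isLt; have := s'.2; split_ifs at h <;> omega
      · exfalso; have := i'.isLt; omega
      · exact congrArg Sum.inr (congrArg Sum.inl (Fin.ext (by omega)))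
      · exfalso; have := i.isLt; have := s'.2; have := s'.1.isLt; split_ifs at h <;> omega
      · exfalso; have := i'.isLt; have := s.2; split_ifs at h <;> omega
      · exfalso; have := i'.isLt; have := s.2; have := s.1.isLt; split_ifs at h <;> omega
      · refine congrArg Sum.inr (congrArg Sum.inr (Subtype.ext (Fin.ext ?_)))
        have := s.2; have := s'.2; split_ifs at h <;> omega)
    (by simp only [Fintype.card_sum, Fintype.card_fin, hcardC]; omega)
  have hfib : ∀ x : ZMod N → X,
      ∫ γ : ZMod N → Γ, α (fun i : Fin (r + 2) => x ((i : ℕ) : ZMod N))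
          (fun i : Fin (r + 1) => γ ((i : ℕ) : ZMod N)) *
          β (fun i : Fin (r + 2) => x ((r + a + 3 + (i : ℕ) : ℕ) : ZMod N))
            (fun i : Fin (r + 1) => γ ((r + a + 3 + (i : ℕ) : ℕ) : ZMod N)) *
          ∏ t : ZMod N, c (x t) (γ t) (x (t + 1)) ∂(Measure.pi fun _ => ν) =
        (∫ γs : Fin (r + 1) → Γ, α (fun i : Fin (r + 2) => x ((i : ℕ) : ZMod N)) γs *
            ∏ i : Fin (r + 1), c ((fun i : Fin (r + 2) => x ((i : ℕ) : ZMod N)) (Fin.castSucc i)) (γs i)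
              ((fun i : Fin (r + 2) => x ((i : ℕ) : ZMod N)) (Fin.succ i)) ∂(Measure.pi fun _ => ν)) *
          ((∫ γs : Fin (r + 1) → Γ, β (fun i : Fin (r + 2) => x ((r + a + 3 + (i : ℕ) : ℕ) : ZMod N)) γs *
              ∏ i : Fin (r + 1), c ((fun i : Fin (r + 2) => x ((r + a + 3 + (i : ℕ) : ℕ) : ZMod N))
                (Fin.castSucc i)) (γs i) ((fun i : Fin (r + 2) => x ((r + a + 3 + (i : ℕ) : ℕ) : ZMod N))
                (Fin.succ i)) ∂(Measure.pi fun _ => ν)) *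
            ∏ s : {s : Fin (1 + (a + 2 + (b' + 1 + 1)) + 1) // ¬((s : ℕ) = 0 ∨ (s : ℕ) = a + 2 + 1)},
              ∫ γ, c (x ((if (s.1 : ℕ) = 0 then 0 else if (s.1 : ℕ) ≤ a + 3 then r + (s.1 : ℕ)
                else 2 * r + (s.1 : ℕ) : ℕ) : ZMod N)) γ
                (x (((if (s.1 : ℕ) = 0 then 0 else if (s.1 : ℕ) ≤ a + 3 then r + (s.1 : ℕ)
                  else 2 * r + (s.1 : ℕ) : ℕ) : ZMod N) + 1)) ∂ν) := by
    intro x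
    have h := slab_integral_pi_window_two ν ef (fun t γ => c (x t) γ (x (t + 1)))
      (α fun i : Fin (r + 2) => x ((i : ℕ) : ZMod N))
      (β fun i : Fin (r + 2) => x ((r + a + 3 + (i : ℕ) : ℕ) : ZMod N))
    simp only [hef, Sum.elim_inl, Sum.elim_inr] at h
    rw [h]
    congr 1
    · refine integral_congr_ae (Eventually.of_forall fun γs => ?_)
      dsimp only
      congr 1
      refine Fintype.prod_congr _ _ fun i => ?_
      simp only [Fin.val_castSucc, Fin.val_succ, Nat.cast_succ]
    · congr 1
      refine integral_congr_ae (Eventually.of_forall fun γs => ?_)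
      dsimp only
      congr 1
      refine Fintype.prod_congr _ _ fun i => ?_
      have hi : ((r + a + 3 + (i : ℕ) : ℕ) : ZMod N) + 1 = ((r + a + 3 + ((i : ℕ) + 1) : ℕ) : ZMod N) := by
        push_cast; ring
      simp only [Fin.val_castSucc, Fin.val_succ, hi]
  refine (integral_congr_ae (Eventually.of_forall fun x => hfib x)).trans ?_
  -- Step 3: contraction of the two block interiors
  obtain ⟨es, hes⟩ := slab_zmod_equiv (N := N)
    (Sum.elim (fun s : Fin (1 + (a + 2 + (b' + 1 + 1)) + 1) =>
        if (s : ℕ) = 0 then 0 else if (s : ℕ) ≤ a + 3 then r + (s : ℕ) else 2 * r + (s : ℕ))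
      (Sum.elim (fun j : Fin r => (j : ℕ) + 1) (fun j : Fin r => r + a + 4 + (j : ℕ))))
    (by
      rintro (s | j | j)
      · simp only [Sum.elim_inl]; have := s.isLt; split_ifs <;> omega
      · simp only [Sum.elim_inr, Sum.elim_inl]; have := j.isLt; omega
      · simp only [Sum.elim_inr]; have := j.isLt; omega)
    (by
      rintro (s | j | j) (s' | j' | j') h <;> simp only [Sum.elim_inl, Sum.elim_inr] at h
      · refine congrArg Sum.inl (Fin.ext ?_); split_ifs at h <;> omega
      · exfalso; have := j'.isLt; split_ifs at h <;> omega
      · exfalso; have := j'.isLt; have := s.isLt; split_ifs at h <;> omega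
      · exfalso; have := j.isLt; split_ifs at h <;> omega
      · exact congrArg Sum.inr (congrArg Sum.inl (Fin.ext (by omega)))
      · exfalso; have := j.isLt; omega
      · exfalso; have := j.isLt; have := s'.isLt; split_ifs at h <;> omega
      · exfalso; have := j'.isLt; omega
      · exact congrArg Sum.inr (congrArg Sum.inr (Fin.ext (by omega))))
    (by simp only [Fintype.card_sum, Fintype.card_fin]; omega)
  have hΨαm := slab_blockWeight_measurable (ν := ν) hc hα
  have hΨβm := slab_blockWeight_measurable (ν := ν) hc hβ
  have hKm := slab_kernel_measurable (ν := ν) hc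
  have hGm : Measurable fun x : ZMod N → X =>
      (∫ γs : Fin (r + 1) → Γ, α (fun i : Fin (r + 2) => x ((i : ℕ) : ZMod N)) γs *
          ∏ i : Fin (r + 1), c ((fun i : Fin (r + 2) => x ((i : ℕ) : ZMod N)) (Fin.castSucc i)) (γs i)
            ((fun i : Fin (r + 2) => x ((i : ℕ) : ZMod N)) (Fin.succ i)) ∂(Measure.pi fun _ => ν)) *
        ((∫ γs : Fin (r + 1) → Γ, β (fun i : Fin (r + 2) => x ((r + a + 3 + (i : ℕ) : ℕ) : ZMod N)) γs *
            ∏ i : Fin (r + 1), c ((fun i : Fin (r + 2) => x ((r + a + 3 + (i : ℕ) : ℕ) : ZMod N))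
              (Fin.castSucc i)) (γs i) ((fun i : Fin (r + 2) => x ((r + a + 3 + (i : ℕ) : ℕ) : ZMod N))
              (Fin.succ i)) ∂(Measure.pi fun _ => ν)) *
          ∏ s : {s : Fin (1 + (a + 2 + (b' + 1 + 1)) + 1) // ¬((s : ℕ) = 0 ∨ (s : ℕ) = a + 2 + 1)},
            ∫ γ, c (x ((if (s.1 : ℕ) = 0 then 0 else if (s.1 : ℕ) ≤ a + 3 then r + (s.1 : ℕ)
              else 2 * r + (s.1 : ℕ) : ℕ) : ZMod N)) γ
              (x (((if (s.1 : ℕ) = 0 then 0 else if (s.1 : ℕ) ≤ a + 3 then r + (s.1 : ℕ)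
                else 2 * r + (s.1 : ℕ) : ℕ) : ZMod N) + 1)) ∂ν) := by
    refine Measurable.mul ?_ (Measurable.mul ?_ (Finset.measurable_prod _ fun s _ => ?_))
    · exact hΨαm.comp (measurable_pi_lambda _ fun i : Fin (r + 2) => measurable_pi_apply (((i : ℕ) : ZMod N)))
    · exact hΨβm.comp (measurable_pi_lambda _ fun i : Fin (r + 2) =>
        measurable_pi_apply (((r + a + 3 + (i : ℕ) : ℕ) : ZMod N)))
    · have h1 : Measurable fun x : ZMod N → X => x ((if (s.1 : ℕ) = 0 then 0 else if (s.1 : ℕ) ≤ a + 3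
          then r + (s.1 : ℕ) else 2 * r + (s.1 : ℕ) : ℕ) : ZMod N) := measurable_pi_apply _
      have h2 : Measurable fun x : ZMod N → X => x (((if (s.1 : ℕ) = 0 then 0 else if (s.1 : ℕ) ≤ a + 3
          then r + (s.1 : ℕ) else 2 * r + (s.1 : ℕ) : ℕ) : ZMod N) + 1) := measurable_pi_apply _
      exact hKm.comp (h1.prodMk h2)
  have hGb : ∀ x : ZMod N → X,
      ‖(∫ γs : Fin (r + 1) → Γ, α (fun i : Fin (r + 2) => x ((i : ℕ) : ZMod N)) γs *
          ∏ i : Fin (r + 1), c ((fun i : Fin (r + 2) => x ((i : ℕ) : ZMod N)) (Fin.castSucc i)) (γs i)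
            ((fun i : Fin (r + 2) => x ((i : ℕ) : ZMod N)) (Fin.succ i)) ∂(Measure.pi fun _ => ν)) *
        ((∫ γs : Fin (r + 1) → Γ, β (fun i : Fin (r + 2) => x ((r + a + 3 + (i : ℕ) : ℕ) : ZMod N)) γs *
            ∏ i : Fin (r + 1), c ((fun i : Fin (r + 2) => x ((r + a + 3 + (i : ℕ) : ℕ) : ZMod N))
              (Fin.castSucc i)) (γs i) ((fun i : Fin (r + 2) => x ((r + a + 3 + (i : ℕ) : ℕ) : ZMod N))
              (Fin.succ i)) ∂(Measure.pi fun _ => ν)) *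
          ∏ s : {s : Fin (1 + (a + 2 + (b' + 1 + 1)) + 1) // ¬((s : ℕ) = 0 ∨ (s : ℕ) = a + 2 + 1)},
            ∫ γ, c (x ((if (s.1 : ℕ) = 0 then 0 else if (s.1 : ℕ) ≤ a + 3 then r + (s.1 : ℕ)
              else 2 * r + (s.1 : ℕ) : ℕ) : ZMod N)) γ
              (x (((if (s.1 : ℕ) = 0 then 0 else if (s.1 : ℕ) ≤ a + 3 then r + (s.1 : ℕ)
                else 2 * r + (s.1 : ℕ) : ℕ) : ZMod N) + 1)) ∂ν)‖ ≤
        Cα * Cc ^ (r + 1) * (Cβ * Cc ^ (r + 1) *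
          Cc ^ Fintype.card {s : Fin (1 + (a + 2 + (b' + 1 + 1)) + 1) // ¬((s : ℕ) = 0 ∨ (s : ℕ) = a + 2 + 1)}) :=
      fun x => by
    rw [norm_mul, norm_mul, Real.norm_eq_abs, Real.norm_eq_abs, Real.norm_eq_abs]
    have hA := slab_blockWeight_abs_le' (ν := ν) hc hcb hαb (fun i : Fin (r + 2) => x ((i : ℕ) : ZMod N))
    have hB := slab_blockWeight_abs_le' (ν := ν) hc hcb hβb
      (fun i : Fin (r + 2) => x ((r + a + 3 + (i : ℕ) : ℕ) : ZMod N))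
    have hR0 : 0 ≤ ∏ s : {s : Fin (1 + (a + 2 + (b' + 1 + 1)) + 1) // ¬((s : ℕ) = 0 ∨ (s : ℕ) = a + 2 + 1)},
        ∫ γ, c (x ((if (s.1 : ℕ) = 0 then 0 else if (s.1 : ℕ) ≤ a + 3 then r + (s.1 : ℕ)
          else 2 * r + (s.1 : ℕ) : ℕ) : ZMod N)) γ
          (x (((if (s.1 : ℕ) = 0 then 0 else if (s.1 : ℕ) ≤ a + 3 then r + (s.1 : ℕ)
            else 2 * r + (s.1 : ℕ) : ℕ) : ZMod N) + 1)) ∂ν :=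
      Finset.prod_nonneg fun s _ => (slab_kernel_bounds hcb _ _).1
    have hRb : ∏ s : {s : Fin (1 + (a + 2 + (b' + 1 + 1)) + 1) // ¬((s : ℕ) = 0 ∨ (s : ℕ) = a + 2 + 1)},
        ∫ γ, c (x ((if (s.1 : ℕ) = 0 then 0 else if (s.1 : ℕ) ≤ a + 3 then r + (s.1 : ℕ)
          else 2 * r + (s.1 : ℕ) : ℕ) : ZMod N)) γ
          (x (((if (s.1 : ℕ) = 0 then 0 else if (s.1 : ℕ) ≤ a + 3 then r + (s.1 : ℕ)
            else 2 * r + (s.1 : ℕ) : ℕ) : ZMod N) + 1)) ∂ν ≤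
        Cc ^ Fintype.card {s : Fin (1 + (a + 2 + (b' + 1 + 1)) + 1) // ¬((s : ℕ) = 0 ∨ (s : ℕ) = a + 2 + 1)} :=
      calc _ ≤ ∏ _s : {s : Fin (1 + (a + 2 + (b' + 1 + 1)) + 1) // ¬((s : ℕ) = 0 ∨ (s : ℕ) = a + 2 + 1)}, Cc :=
            Finset.prod_le_prod (fun s _ => (slab_kernel_bounds hcb _ _).1) fun s _ => (slab_kernel_bounds hcb _ _).2
        _ = _ := by simp
    rw [abs_of_nonneg hR0]
    have hB0 : 0 ≤ Cβ * Cc ^ (r + 1) := (abs_nonneg _).trans hB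
    exact mul_le_mul hA (mul_le_mul hB hRb hR0 hB0) (mul_nonneg (abs_nonneg _) hR0) ((abs_nonneg _).trans hA)
  refine (slab_integral_pi_split μ es hGm hGb).trans ?_
  refine integral_congr_ae (Eventually.of_forall fun W => ?_)
  -- Step 4: identification of the sites
  have hA' : ∀ (v : Fin r ⊕ Fin r → X) (i : Fin (r + 2)),
      Sum.elim W v (es.symm ((i : ℕ) : ZMod N)) =
        (Fin.cons (W 0) (Fin.snoc (fun j => v (Sum.inl j)) (W 1)) : Fin (r + 2) → X) i := by
    intro v i
    refine Fin.cases ?_ (fun j => ?_) i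
    · have h : es.symm (((0 : Fin (r + 2)) : ℕ) : ZMod N) = Sum.inl 0 := by
        rw [Equiv.symm_apply_eq, hes, Sum.elim_inl]; simp
      rw [h, Sum.elim_inl, Fin.cons_zero]
    · rw [Fin.cons_succ]
      refine Fin.lastCases ?_ (fun j' => ?_) j
      · have h : es.symm ((((Fin.last r).succ : Fin (r + 2)) : ℕ) : ZMod N) = Sum.inl 1 := by
          rw [Equiv.symm_apply_eq, hes, Sum.elim_inl, hv1, if_neg one_ne_zero, if_pos (by omega)]; simp
        rw [h, Sum.elim_inl, Fin.snoc_last]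
      · have h : es.symm (((j'.castSucc.succ : Fin (r + 2)) : ℕ) : ZMod N) = Sum.inr (Sum.inl j') := by
          rw [Equiv.symm_apply_eq, hes, Sum.elim_inr, Sum.elim_inl]; simp
        rw [h, Sum.elim_inr, Fin.snoc_castSucc]
  have hB' : ∀ (v : Fin r ⊕ Fin r → X) (i : Fin (r + 2)),
      Sum.elim W v (es.symm ((r + a + 3 + (i : ℕ) : ℕ) : ZMod N)) =
        (Fin.cons (W c3) (Fin.snoc (fun j => v (Sum.inr j)) (W (c3 + 1))) : Fin (r + 2) → X) i := by
    intro v i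
    refine Fin.cases ?_ (fun j => ?_) i
    · have h : es.symm (((r + a + 3 + ((0 : Fin (r + 2)) : ℕ) : ℕ)) : ZMod N) = Sum.inl c3 := by
        rw [Equiv.symm_apply_eq, hes, Sum.elim_inl, hvc3, if_neg (by omega), if_pos (by omega), Fin.val_zero]
        congr 1
      rw [h, Sum.elim_inl, Fin.cons_zero]
    · rw [Fin.cons_succ]
      refine Fin.lastCases ?_ (fun j' => ?_) j
      · have h : es.symm (((r + a + 3 + (((Fin.last r).succ : Fin (r + 2)) : ℕ) : ℕ)) : ZMod N) =
            Sum.inl (c3 + 1) := by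
          rw [Equiv.symm_apply_eq, hes, Sum.elim_inl, hvc4, if_neg (by omega), if_neg (by omega), Fin.val_succ,
            Fin.val_last]
          congr 1; omega
        rw [h, Sum.elim_inl, Fin.snoc_last]
      · have h : es.symm (((r + a + 3 + ((j'.castSucc.succ : Fin (r + 2)) : ℕ) : ℕ)) : ZMod N) =
            Sum.inr (Sum.inr j') := by
          rw [Equiv.symm_apply_eq, hes, Sum.elim_inr, Sum.elim_inr, Fin.val_succ, Fin.val_castSucc]
          congr 1; omega
        rw [h, Sum.elim_inr, Fin.snoc_castSucc]
  have hR1 : ∀ (v : Fin r ⊕ Fin r → X)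
      (s : {s : Fin (1 + (a + 2 + (b' + 1 + 1)) + 1) // ¬((s : ℕ) = 0 ∨ (s : ℕ) = a + 2 + 1)}),
      Sum.elim W v (es.symm ((if (s.1 : ℕ) = 0 then 0 else if (s.1 : ℕ) ≤ a + 3 then r + (s.1 : ℕ)
        else 2 * r + (s.1 : ℕ) : ℕ) : ZMod N)) = W s.1 := by
    intro v s
    have h : es.symm ((if (s.1 : ℕ) = 0 then 0 else if (s.1 : ℕ) ≤ a + 3 then r + (s.1 : ℕ)
        else 2 * r + (s.1 : ℕ) : ℕ) : ZMod N) = Sum.inl s.1 := by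
      rw [Equiv.symm_apply_eq, hes, Sum.elim_inl]
    rw [h, Sum.elim_inl]
  have hR2 : ∀ (v : Fin r ⊕ Fin r → X)
      (s : {s : Fin (1 + (a + 2 + (b' + 1 + 1)) + 1) // ¬((s : ℕ) = 0 ∨ (s : ℕ) = a + 2 + 1)}),
      Sum.elim W v (es.symm (((if (s.1 : ℕ) = 0 then 0 else if (s.1 : ℕ) ≤ a + 3 then r + (s.1 : ℕ)
        else 2 * r + (s.1 : ℕ) : ℕ) : ZMod N) + 1)) = W (s.1 + 1) := by
    intro v s
    have hs := s.2
    have h : es.symm (((if (s.1 : ℕ) = 0 then 0 else if (s.1 : ℕ) ≤ a + 3 then r + (s.1 : ℕ)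
        else 2 * r + (s.1 : ℕ) : ℕ) : ZMod N) + 1) = Sum.inl (s.1 + 1) := by
      rw [Equiv.symm_apply_eq, hes, Sum.elim_inl, Fin.val_add_one]
      by_cases hl : s.1 = Fin.last _
      · have hv : (s.1 : ℕ) = 1 + (a + 2 + (b' + 1 + 1)) := by
          have := congrArg Fin.val hl; rwa [Fin.val_last] at this
        rw [if_pos hl, if_pos rfl, if_neg (by omega), if_neg (by omega), ← Nat.cast_add_one,
          show 2 * r + (s.1 : ℕ) + 1 = N by omega, ZMod.natCast_self, Nat.cast_zero]
      · have hne : (s.1 : ℕ) ≠ 1 + (a + 2 + (b' + 1 + 1)) := fun h =>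
          hl (Fin.ext (h.trans (Fin.val_last _).symm))
        have hlt := s.1.isLt
        rw [if_neg hl, if_neg (Nat.add_one_ne_zero _)]
        split_ifs <;> first | (exfalso; omega) | (push_cast; ring)
    rw [h, Sum.elim_inl]
  have hsplit := slab_integral_pi_two_blocks μ (Equiv.refl (Fin r ⊕ Fin r))
    (fun v' : Fin r → X => ∫ γs : Fin (r + 1) → Γ, α (Fin.cons (W 0) (Fin.snoc v' (W 1))) γs *
      ∏ i : Fin (r + 1), c ((Fin.cons (W 0) (Fin.snoc v' (W 1)) : Fin (r + 2) → X) (Fin.castSucc i)) (γs i)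
        ((Fin.cons (W 0) (Fin.snoc v' (W 1)) : Fin (r + 2) → X) (Fin.succ i)) ∂(Measure.pi fun _ => ν))
    (fun v' : Fin r → X => ∫ γs : Fin (r + 1) → Γ, β (Fin.cons (W c3) (Fin.snoc v' (W (c3 + 1)))) γs *
      ∏ i : Fin (r + 1), c ((Fin.cons (W c3) (Fin.snoc v' (W (c3 + 1))) : Fin (r + 2) → X) (Fin.castSucc i))
        (γs i) ((Fin.cons (W c3) (Fin.snoc v' (W (c3 + 1))) : Fin (r + 2) → X) (Fin.succ i))
        ∂(Measure.pi fun _ => ν))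
  simp only [Equiv.refl_apply] at hsplit
  simp only [hA', hB', hR1, hR2, ← mul_assoc]
  rw [integral_mul_const, hsplit]
  -- Step 5: the heterogeneous bond product on the outer cycle
  rw [← Finset.prod_mul_prod_compl ({0, c3} : Finset (Fin (1 + (a + 2 + (b' + 1 + 1)) + 1))),
    Finset.prod_pair h0c3,
    Finset.prod_subtype (p := fun t : Fin (1 + (a + 2 + (b' + 1 + 1)) + 1) => ¬((t : ℕ) = 0 ∨ (t : ℕ) = a + 2 + 1))
      (F := inferInstance) _ (fun x => by rw [Finset.mem_compl, hmem])]
  simp only [Fin.val_zero, hvc3, zero_add, if_true, show ¬(a + 2 + 1 = 0) from by omega,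
    show ¬(0 = a + 2 + 1) from by omega, if_false]
  congr 1
  refine Fintype.prod_congr _ _ fun s => ?_
  rw [if_neg (fun h => s.2 (Or.inl h)), if_neg (fun h => s.2 (Or.inr h))]


end Cyclic

end Literature.Analysis.OperatorTheory

end
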